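import Summits.Ventures.HodgeRepro.Statements

/-!
# SexticCoordinatesProof — the degree-6 coordinate census (Statements.lean §A.3) by kernel computation (seat p4)

The four conjuncts of `FaceCensus.Sextic.Coordinates.Census` are closed finite statements about `ZMod 6`
(`8` CM types, `48` faces, the two `k`-induced types, the primitive translation orbit; `SumTwo`; the corner
structure; Pohlmann's `4`-sets of `B × E`); each is decided by the kernel.
-/

set_option autoImplicit false

namespace Summit.Ventures.HodgeRepro.FaceCensus.Sextic.Coordinates

/-- §A.3 clause (1): `8` CM types, `48` faces, the `k`-induced types are `{0,2,4}`, `{1,3,5}`, and every primitive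
type is a translate of `{0,1,2}`. -/
theorem census_part1 : cmTypes.card = 8 ∧ faces.card = 48 ∧ (cmTypes.filter fun T => isInduced T = true) = { {0, 2, 4}, {1, 3, 5} } ∧
    (∀ T ∈ cmTypes, isInduced T = false → ∃ m : ZMod 6, T = ({0, 1, 2} : Finset (ZMod 6)).image fun i => i + m) := by
  decide +kernel

/-- §A.3 clause (2), `SumTwo`: for every face and every embedding `i`, exactly two of the four corners contain `i`. -/
theorem census_part2 : ∀ f ∈ faces, ∀ i : ZMod 6, ((corners f.1 f.2.1 f.2.2).filter fun T => i ∈ T).length = 2 := by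
  decide +kernel

/-- §A.3 clause (3), corner structure: four pairwise distinct CM-type corners, exactly one `k`-induced, and the three
primitive ones form a full packet `{Ψ, Ψ+2, Ψ+4}`. -/
theorem census_part3 : ∀ f ∈ faces,
    (corners f.1 f.2.1 f.2.2).Nodup ∧ (∀ T ∈ corners f.1 f.2.1 f.2.2, T ∈ cmTypes) ∧
    ((corners f.1 f.2.1 f.2.2).filter fun T => isInduced T = true).length = 1 ∧
    (∃ Ψ ∈ corners f.1 f.2.1 f.2.2, isInduced Ψ = false ∧
      Ψ.image (fun i => i + 2) ∈ corners f.1 f.2.1 f.2.2 ∧ Ψ.image (fun i => i + 4) ∈ corners f.1 f.2.1 f.2.2) := by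
  decide +kernel

/-- §A.3 clause (4), Pohlmann census of `Y = B × E`: `B¹ = 4`, `B² = 8`, and the two `c`-unstable `4`-sets are
`{σ⁰,σ²,σ⁴} ⊔ {e₀}` and `{σ¹,σ³,σ⁵} ⊔ {e₁}` (the Weil plane). -/
theorem census_part4 : divisorSets.card = 4 ∧ hodgeSets.card = 8 ∧
    (hodgeSets.filter fun P => ∃ x ∈ P, act 3 x ∉ P) =
      { {Sum.inl 0, Sum.inl 2, Sum.inl 4, Sum.inr 0}, {Sum.inl 1, Sum.inl 3, Sum.inl 5, Sum.inr 1} } := by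
  decide +kernel

/-- **Degree-6 census in coordinates** (`FaceCensus.Sextic.Coordinates.Census` of Statements.lean §A.3). -/
theorem census : Census := ⟨census_part1, census_part2, census_part3, census_part4⟩

end Summit.Ventures.HodgeRepro.FaceCensus.Sextic.Coordinates
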